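import Summits.QuantumFields.YangMills.Theorems.BalabanUVNodesN15CovariantLandauNeumannRows
import Summits.QuantumFields.YangMills.Theorems.BalabanUVNodesN15CovariantLandauLetterRows
import Summits.QuantumFields.YangMills.Theorems.BalabanUVNodesN15PerCubeGreenSopLetters
import Summits.QuantumFields.YangMills.Theorems.BalabanUVNodesN15PerCubeGreenFineSummand
import HarnessLib

/-!
# N15 = NE2, road (c) — PROGRAMME (PC), TOWARDS ENTRY 3 OF (3.42): THE BLOCK ROW OF BAŁABAN's COVARIANT AVERAGING SUMMAND `P = a·Q′_T(U)ᵀQ′_T(U)` FOR AN ARBITRARY UNITARY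
# BOND FIELD — `P ≤ |a|·n^{−(d+1)}·|ι|²·e^{−δd}` blockwise on both grids (no small-field hypothesis: the staircase transports of a unitary field are orthogonal), the input `hP′` of
# n15-c∕376 `hasMaj_idef_entryThree` (dag-n15-c g34, n15-c∕377)

Cell `pub-ymgap`, seat `pub-ymgap-dag-n15-c` (generation g34; R134 (a) seat, strategy s1 «first missing estimate»; HUMAN RULING D-0062; chair R424 venue).
`bears_on: R4∕N15 · K3⁸ SpineGivenEndpointR13SepCoPHV (stmt-QuantumFields-27366)`; filed `--kind proof --supports stmt-QuantumFields-27366 --as helper` — COUNT-NEUTRAL.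
Theorems only, 0 `def`, 0 `sorry`.  Imports BY NAME this seat's `…CovariantLandauNeumannRows` (`hasMaj_csavg`),
`…CovariantLandauLetterRows` (`hasMaj_csavg_transpose`), `…PerCubeGreenSopLetters` (`rows_cvaStair_cvT_le`, `cols_cvaStair_cvT_le`), `…PerCubeGreenSummand` ∕ `…PerCubeGreenFineSummand` (`scP`,
`scP′`).  Nothing in the tree is modified, no landed name re-declared.

WHAT.  ★★ `hasMaj_scP_of_unitary` (coarse sites) ∕ ★★ `hasMaj_scP'_of_unitary` (fine sites): for EVERY unitary bond field `U` (`U_μ(x)ᴴU_μ(x) = 1`), trace-form coordinates `e`, mass `a` and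
rate `δ`, `HasMaj ScNorm ScNorm (scP … a ι e U) (|a|·n^{−(d+1)}·|ι|²·e^{−δ·dist})` — `P = a·Q′_Tᵀ∘Q′_T` factorised through the block carrier (`hasMaj_csavg`: row `𝟙·|ι|`;
`hasMaj_csavg_transpose`: row `𝟙·n^{−(d+1)}|ι|`; the letters `|ι|` from the orthogonality of the staircase transports `T(Γ) = cvT e U` along King's staircases), composed (`hasMaj_comp`, cutting
cost `κ = 1` of the sharp block norm), scaled into the block sup (`B11AxialTransport190.loc_ofBlocks_le` ∕ `abs_le_loc_ofBlocks`), and the diagonal indicator dominated by `e^{−δ·dist}`.  With `a = a_K·n^{d+1}` (King's mass) the row is `a_K|ι|²` —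
uniform in the grid.

HONEST FRAMING ∕ LIMITS.  Block-norm bookkeeping; nothing of [B9] asserted ((3.19) p.393, (3.24) p.394 = SHAPES).  NE2⁺ NOT PRINTED ∕ NOT proved; N15 of record untouched (DISCHARGED AS
CONSUMED, p687738); K3⁸ OPEN; counts of record UNMOVED (typed 28∕28 · discharged 8∕27); one finite 𝕋⁴ at fixed ε per index — NOT infinite volume, NOT OS on ℝ⁴, NOT a mass gap, NOT Clay.
Restate-immune (no Theses import).
-/

set_option autoImplicit false

noncomputable section

open scoped BigOperators Matrix Matrix.Norms.L2Operator
open Finset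

namespace Summit.QuantumFields.YangMills.BalabanUVNodes.N15.Gluing

open Literature.MathematicalPhysics.QuantumFieldTheory.Balaban1983to89
open Literature.MathematicalPhysics.QuantumFieldTheory.Balaban1983to89.B5Prop11Plancherel (Tor fine)
open Literature.MathematicalPhysics.QuantumFieldTheory.Balaban1983to89.B11SectG (BlockNorm HasMaj hasMaj_comp)
open Literature.MathematicalPhysics.QuantumFieldTheory.Balaban1983to89.B6UnitTorusCarrier (unitTorusGeo unitTorusGeo_dist_self)
open Literature.Barriers.QuantumFields (traceForm)
open Summit.QuantumFields.YangMills.BalabanUVNodes.N15.MatrixSpecies (liftBlk)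
open Summit.QuantumFields.YangMills.BalabanUVNodes.N15.CovLandau (csavg hasMaj_csavg hasMaj_csavg_transpose)
open Literature.MathematicalPhysics.QuantumFieldTheory.Balaban1983to89.B11AxialTransport190 (abs_le_loc_ofBlocks loc_ofBlocks_le)

variable {d : ℕ} {L : ℕ} [NeZero L] {mv kk r : ℕ} {hL : Odd L ∧ 1 < L} (ι : Type) [Fintype ι] [DecidableEq ι] {mm : Type} [Fintype mm] [DecidableEq mm] (e : Matrix mm mm ℂ ≃L[ℝ] (ι → ℝ))

omit [NeZero L] in
/-- ★ generic core: for a unitary bond field on `Tor (fine n M)` the operator `mulVecLin (a • ((Q′_T)ᵀ * Q′_T))` has the block row `|a|·n^{−(d+1)}·|ι|²·e^{−δ·dist}` between the sharp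
block norms of the unit-torus geometry. [cite: Balaban1985BackgroundPropagators, (3.19) p.393, (3.24) p.394 (shapes)] -/
theorem hasMaj_csavgSq_of_unitary (M : Fin (d + 1) → ℕ) [∀ μ, NeZero (M μ)] (n : ℕ) [NeZero n] (k : ℕ) (he : ∀ A B : Matrix mm mm ℂ, traceForm A B = e A ⬝ᵥ e B)
    {U : Fin (d + 1) → Tor (fine n M) → Matrix mm mm ℂ} (hU : ∀ μ x, (U μ x)ᴴ * U μ x = 1) (a δ : ℝ) :
    HasMaj (BlockNorm.ofBlocks (unitTorusGeo L k M) (liftBlk (Literature.MathematicalPhysics.QuantumFieldTheory.King1986.Torus.blockOf n M) ι)) (BlockNorm.ofBlocks (unitTorusGeo L k M) (liftBlk (Literature.MathematicalPhysics.QuantumFieldTheory.King1986.Torus.blockOf n M) ι))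
      (Matrix.mulVecLin (a • ((csavg M n (cvT e U))ᵀ * csavg M n (cvT e U))))
      (fun y y' => |a| * ((n : ℝ) ^ (d + 1))⁻¹ * (Fintype.card ι : ℝ) ^ 2 * Real.exp (-(δ * (unitTorusGeo L k M).dist y y'))) := by
  classical
  have hι0 : (0 : ℝ) ≤ Fintype.card ι := Nat.cast_nonneg _
  have hn : (0 : ℝ) < (n : ℝ) ^ (d + 1) := pow_pos (Nat.cast_pos.mpr (Nat.pos_of_ne_zero (NeZero.ne n))) _
  have h1 := hasMaj_csavg M n (L := L) (k := k) (cvT e U) hι0 (fun y a' i => rows_cvaStair_cvT_le M n e he hU y a' 0 i)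
  have h2 := hasMaj_csavg_transpose M n (L := L) (k := k) (cvT e U) hι0 (fun y a' i => cols_cvaStair_cvT_le M n e he hU y a' 0 i)
  have h3 := hasMaj_comp h2 h1 (fun y y' => by split_ifs <;> positivity)
  have hlin : Matrix.mulVecLin (a • ((csavg M n (cvT e U))ᵀ * csavg M n (cvT e U))) =
      a • (Matrix.mulVecLin (csavg M n (cvT e U))ᵀ ∘ₗ Matrix.mulVecLin (csavg M n (cvT e U))) := by
    rw [← Matrix.mulVecLin_mul]
    refine LinearMap.ext fun v => ?_
    simp only [Matrix.mulVecLin_apply, LinearMap.smul_apply, Matrix.smul_mulVec]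
  rw [hlin]
  have hκ : (BlockNorm.ofBlocks (unitTorusGeo L k M) (liftBlk (fun y : Tor M => y) ι)).κ = 1 := rfl
  rw [hκ] at h3
  -- the diagonal sum collapses to `𝟙[y = y′]·n^{−(d+1)}|ι|²`
  have hK0 : ∀ y y' : Tor M, 0 ≤ ∑ y'' : Tor M, (if y = y'' then ((n : ℝ) ^ (d + 1))⁻¹ * (Fintype.card ι : ℝ) else 0) * (1 * (if y'' = y' then (Fintype.card ι : ℝ) else 0)) :=
    fun y y' => Finset.sum_nonneg fun y'' _ => mul_nonneg (by split_ifs <;> positivity) (mul_nonneg zero_le_one (by split_ifs <;> positivity))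
  have hKle : ∀ y y' : Tor M, ∑ y'' : Tor M, (if y = y'' then ((n : ℝ) ^ (d + 1))⁻¹ * (Fintype.card ι : ℝ) else 0) * (1 * (if y'' = y' then (Fintype.card ι : ℝ) else 0)) ≤
      ((n : ℝ) ^ (d + 1))⁻¹ * (Fintype.card ι : ℝ) ^ 2 * Real.exp (-(δ * (unitTorusGeo L k M).dist y y')) := by
    intro y y'
    by_cases hyy : y = y'
    · subst hyy
      rw [Finset.sum_eq_single y (fun y'' _ hne => by rw [if_neg (Ne.symm hne)]; ring) (fun h => absurd (Finset.mem_univ y) h), if_pos rfl, if_pos rfl, unitTorusGeo_dist_self, mul_zero,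
        neg_zero, Real.exp_zero]
      nlinarith [hn, hι0, inv_nonneg.mpr hn.le]
    · rw [Finset.sum_eq_zero (fun y'' _ => by
        by_cases h1' : y = y''
        · subst h1'; rw [if_neg hyy]; ring
        · rw [if_neg h1']; ring)]
      positivity
  -- scaling by `a` into the sharp block norm (`loc` is the block sup of `|·|`)
  intro y' μ hμ y
  have hmain := h3 y' μ hμ y
  refine loc_ofBlocks_le _ _ (mul_nonneg (by have := hKle y y'; positivity) ((BlockNorm.ofBlocks _ _).loc_nonneg y' μ)) fun x hx => ?_
  rw [LinearMap.smul_apply, Pi.smul_apply, smul_eq_mul, abs_mul]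
  calc |a| * |((Matrix.mulVecLin (csavg M n (cvT e U))ᵀ ∘ₗ Matrix.mulVecLin (csavg M n (cvT e U))) μ) x|
      ≤ |a| * ((∑ y'' : Tor M, (if y = y'' then ((n : ℝ) ^ (d + 1))⁻¹ * (Fintype.card ι : ℝ) else 0) * (1 * (if y'' = y' then (Fintype.card ι : ℝ) else 0))) *
          (BlockNorm.ofBlocks (unitTorusGeo L k M) (liftBlk (Literature.MathematicalPhysics.QuantumFieldTheory.King1986.Torus.blockOf n M) ι)).loc y' μ) :=
        mul_le_mul_of_nonneg_left ((abs_le_loc_ofBlocks _ _ hx).trans hmain) (abs_nonneg a)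
    _ ≤ |a| * ((((n : ℝ) ^ (d + 1))⁻¹ * (Fintype.card ι : ℝ) ^ 2 * Real.exp (-(δ * (unitTorusGeo L k M).dist y y'))) *
          (BlockNorm.ofBlocks (unitTorusGeo L k M) (liftBlk (Literature.MathematicalPhysics.QuantumFieldTheory.King1986.Torus.blockOf n M) ι)).loc y' μ) :=
        mul_le_mul_of_nonneg_left (mul_le_mul_of_nonneg_right (hKle y y') ((BlockNorm.ofBlocks _ _).loc_nonneg y' μ)) (abs_nonneg a)
    _ = _ := by ring

/-- ★★ **THE BLOCK ROW OF THE COVARIANT AVERAGING SUMMAND FOR A UNITARY FIELD, COARSE SITES**: `scP … a ι e U ≤ |a|·(L^k)^{−(d+1)}·|ι|²·e^{−δ·dist}` between dag-n15-w3's sharp block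
norms `ScNorm`, for EVERY unitary `U`, every `a`, `δ`. [cite: Balaban1985BackgroundPropagators, (3.24) p.394 (shape)] -/
theorem hasMaj_scP_of_unitary (he : ∀ A B : Matrix mm mm ℂ, traceForm A B = e A ⬝ᵥ e B) {U : Fin (d + 1) → ScX d L mv kk hL → Matrix mm mm ℂ} (hU : ∀ μ x, (U μ x)ᴴ * U μ x = 1)
    (a δ : ℝ) :
    HasMaj (ScNorm d L mv kk hL ι) (ScNorm d L mv kk hL ι) (scP d L mv kk hL a ι e U)
      (fun y y' => |a| * ((((L ^ kk : ℕ) : ℝ)) ^ (d + 1))⁻¹ * (Fintype.card ι : ℝ) ^ 2 * Real.exp (-(δ * (unitTorusGeo L kk (cvM d L mv kk hL)).dist y y'))) := by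
  have h := hasMaj_csavgSq_of_unitary (L := L) ι e (cvM d L mv kk hL) (L ^ kk) kk he hU a δ
  rw [Nat.cast_pow] at h ⊢
  exact h

/-- ★★ **THE BLOCK ROW OF THE COVARIANT AVERAGING SUMMAND FOR A UNITARY FIELD, FINE SITES** (unit blocks of the fine grid): `scP′ … a ι e U′ ≤ |a|·(L^rL^k)^{−(d+1)}·|ι|²·e^{−δ·dist}`.
[cite: Balaban1985BackgroundPropagators, (3.24) p.394 (shape)] -/
theorem hasMaj_scP'_of_unitary (he : ∀ A B : Matrix mm mm ℂ, traceForm A B = e A ⬝ᵥ e B) {U' : Fin (d + 1) → ScX' d L mv kk r hL → Matrix mm mm ℂ}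
    (hU' : ∀ μ x, (U' μ x)ᴴ * U' μ x = 1) (a δ : ℝ) :
    HasMaj (ScNorm' d L mv kk r hL ι) (ScNorm' d L mv kk r hL ι) (scP' d L mv kk r hL a ι e U')
      (fun y y' => |a| * ((((L ^ r * L ^ kk : ℕ) : ℝ)) ^ (d + 1))⁻¹ * (Fintype.card ι : ℝ) ^ 2 * Real.exp (-(δ * (unitTorusGeo L kk (cvM d L mv kk hL)).dist y y'))) := by
  have h := hasMaj_csavgSq_of_unitary (L := L) ι e (cvM d L mv kk hL) (L ^ r * L ^ kk) kk he hU' a δ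
  rw [Nat.cast_mul, Nat.cast_pow, Nat.cast_pow] at h ⊢
  exact h

end Summit.QuantumFields.YangMills.BalabanUVNodes.N15.Gluing

end
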